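import Summits.BirchSwinnertonDyer.BirchSwinnertonDyer.Theorems.AdditiveWildRankOneTowerSurjOfKato
import Summits.BirchSwinnertonDyer.Rank1Residual.X11b.UnrSeriesIdealDescent
import HarnessLib

/-!
# The r = 1 LOWER half at an additive prime from an `R₀`-FRAME and the Eisenstein inclusion in `R₀`-currency — the texts of
# route SOED's crux X (`WildSplitEisensteinInclusionAtThree`, 20479) and route UTD's child `WildSplitFrameAtThree` (20928)
# consumed VERBATIM: on the tower-surjective wild rank-one rows, K9's 19200 LOWER half ⟸ 20928 ∧ 20479 ∧ print

Prover seat `bsd-potss-kmc`, gen 20 (cell `bsd-potss`; K9 19200 `WildRankOne`; routes UTD / SOED of cell bsd-wall), 2026-08-27.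
HONEST FRAMING: CONDITIONAL on every displayed hypothesis; 0 definitions, 0 named facts minted, 0 `sorry`; closes nothing; BSD₃
for no curve; no statement of either route is altered or imported by name (their texts are restated as hypotheses, so a glue is
`fun h20928 h20479 => …`).

Gen 20's ♭-currency kernels (`…AdditiveRankOneBSDpRowKernels.lean` §1) build their own ♭-frame from Hsieh 2014 and ask the
Eisenstein inclusion at EVERY ♭-frame. The bsd-wall routes type the frame and the inclusion over `R₀ = 𝓞^unr`
(`UnrSeries 3`, `IsBDPLFunction`, `charIdeal.map (toUnr 3) ≤ span {L}` with a torsion guard). This file reads the lower half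
directly from THOSE texts: given an `R₀`-frame `L` at the chosen anticyclotomic frame (20928's text) and the `R₀`-inclusion at
`L` (20479's text, torsion guard fed by the control equality), the frame is read in `𝓞_{ℂ_p}⟦T⟧`
(`X11b.R1.isBDPLFunctionInt_map`), the inclusion is pushed to `𝓞_{ℂ_p}⟦T⟧` (`X11b.ideal_map_toCpInt_le_span_of_map_toUnr_le`),
the value `L(𝟙) = u·(log_ω P/c)²`, `‖u‖ = 1` is g19's `intSeries_value_of_frame_manin` (LZZ only — no Hsieh input), and the
rest is gen 20's chain (control from facts; twist's r = 0 upper half from Kato A161″ on tower-onto rows).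

* §1 `indexLowerBoundLeAt_of_unrFrame_of_unrInclLe_of_control` — one Heegner datum, generic odd additive `p`: `R₀`-frame
  supply + `R₀`-Eisenstein inclusion (torsion-guarded) + control ⟹ STEP L `IndexLowerBoundLeAt W p K P (v_p c)`.
* §2 `missingLowerBoundAt_of_unrFrame_of_unrEisenstein_of_control_of_twistUpper_row` — row-local r = 1 LOWER half.
* §3 **`missingLowerBoundAt_wildRankOne_towerSurj_of_frame20928_of_eisenstein20479_of_katoTam_of_facts`** — K9's 19200
  binders on the tower-onto rows: `∀ W, r_an = 1 → ClassO6 W 3 → TowerSurjThree W → MissingLowerBoundAt W 3` ⟸ [text of 20928]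
  ∧ [text of 20479] ∧ A161″ ∧ {Poitou–Tate ×2, local Euler–Poincaré, cd ≤ 2, Brink Thm 2 / Cor 1, Serre 1967} ∧ LZZ ∧
  ToricPublishedInputs — every hypothesis a REGISTERED item text or a named fact.

References: [Castella2018] Thm 3.1, §3; [JetchevSkinnerWan2017] §7.4.1, Thm. 3.3.1; [LiuZhangZhang2018] Thm 1.5.1/1.5.3;
[Kato2004Asterisque] Thm. 14.5 (3), Prop. 14.16 (2); [GrossZagier1986] I.(6.3); [Serre1967GroupesPDivisibles] §5 Prop. 8.
-/

noncomputable section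

open scoped Classical

set_option linter.dupNamespace false
set_option autoImplicit false

namespace Summit.BirchSwinnertonDyer.BirchSwinnertonDyer.Theorems.UniversalToricDescentWaldspurgerFlat

open WeierstrassCurve NumberField IsDedekindDomain Field PowerSeries
  Literature.NumberTheory.EllipticCurves
  Literature.NumberTheory.EllipticCurves.ModularForms
  Literature.NumberTheory.EllipticCurves.Rank1Residual
  Literature.NumberTheory.EllipticCurves.Rank1Residual.Typed
  Literature.NumberTheory.EllipticCurves.KrizLi2019
  Literature.NumberTheory.GaloisRepresentations
  Literature.NumberTheory.GaloisCohomology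
  Summit.BirchSwinnertonDyer.Rank1Residual
  Summit.BirchSwinnertonDyer.Rank1Residual.Additive
  Summit.BirchSwinnertonDyer.Rank1Residual.X11b
  Summit.BirchSwinnertonDyer.Rank1Residual.X11b.AcSelmer
  Summit.BirchSwinnertonDyer.Rank1Residual.X11b.Halves
  Summit.BirchSwinnertonDyer.Rank1Residual.X11b.CongruenceLimit
  Summit.BirchSwinnertonDyer.BirchSwinnertonDyer.Theses.UniversalToricDescent
  Summit.BirchSwinnertonDyer.BirchSwinnertonDyer.Theorems.AdditivePotSupersingularControl

/-! ## §1 STEP L from an `R₀`-frame and the `R₀`-Eisenstein inclusion -/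

section Datum

variable {p : ℕ} [Fact p.Prime] {W : WeierstrassCurve ℚ} [W.IsElliptic] [W.IsGloballyMinimal]
  {N : ℕ} [NeZero N] {K : Type} [Field K] [NumberField K]

/-- **STEP L at slack `v_p(c)` from an `R₀`-FRAME and the `R₀`-Eisenstein inclusion + control.** At one Heegner datum
`(N, K, Dt, H, ι, P)` of `W` additive at the odd `p` (`K` imaginary quadratic Heegner for `N = N(E)`, `d_K < −4`, `P` the non-torsion
Heegner point, Kolyvagin for this datum): IF at every anticyclotomic `(κ, γ)` and every `𝔭 ∋ p` some `ι′` inducing `𝔭` carries an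
`R₀`-frame `L` of `Dt.f` (`IsBDPLFunction`), IF at every such frame the inclusion `Ch_Λ(X_(∅,0) at 𝔭′)·R₀⟦T⟧ ⊆ (L)` holds whenever
`X_(∅,0)` at `𝔭′` is `Λ`-torsion, and IF exact control holds at every degree-one `𝔭`, THEN `IndexLowerBoundLeAt W p K P (v_p c)`.
The frame is read in `𝓞_{ℂ_p}⟦T⟧` (`R1.isBDPLFunctionInt_map`), the inclusion pushed there (`ideal_map_toCpInt_le_span_of_map_toUnr_le`),
the torsion guard is the first conjunct of the control equality, and the value `L(𝟙) = u·(log_ω P/c)²`, `‖u‖ = 1`, is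
`intSeries_value_of_frame_manin` (LZZ only). CONDITIONAL; closes nothing. [cite: Castella2018, Thm. 3.1 and §3 (arXiv:1704.06608 pp. 8–9)]
[cite: JetchevSkinnerWan2017, §7.4.1 (arXiv:1512.06894 p. 30)] [cite: LiuZhangZhang2018, Thm 1.5.1 and Thm 1.5.3 (Duke Math. J. 167 pp. 748–749)] -/
theorem indexLowerBoundLeAt_of_unrFrame_of_unrInclLe_of_control (hp2 : p ≠ 2)
    (hL : LiuZhangZhang2018.thm151_thm153_modularCurve_heegnerVector_additive)
    (Dt : ModularParametrizationData W N) (H : HeegnerDatum N (NumberField.discr K)) (ι : K →+* ℂ)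
    (P : (W.baseChange K).toAffine.Point) (haddv : Addv W p) (hN : W.conductorNorm ℤ = N) (hK : IsImaginaryQuadratic K)
    (hHN : SatisfiesHeegnerHypothesis N K) (hd4 : NumberField.discr K < -4)
    (hP : WeierstrassCurve.Affine.Point.map ι.toRatAlgHom P = heegnerPointComplex Dt H) (hnt : ¬ IsOfFinAddOrder P)
    (hKo : Literature.NumberTheory.EllipticCurves.kolyvagin N W K)
    (hFr : ∀ (κ : ZpExtension K p), κ.IsAnticyclotomic → ∀ (γ : Field.absoluteGaloisGroup K) [Fact (κ.IsTopGenerator γ)]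
        (𝔭 : HeightOneSpectrum (𝓞 K)), ((p : ℕ) : 𝓞 K) ∈ 𝔭.asIdeal →
        ∃ ι' : PadicAlgCl p ≃+* ℂ, SchneiderFree.BranchInducesPrime p ι' 𝔭 ∧
          ∃ (ΩK : ℂ) (Ωp : ℂ_[p]) (L : UnrSeries p), ΩK ≠ 0 ∧ Ωp ≠ 0 ∧ IsBDPLFunction ι' 𝔭 κ γ Dt.f ΩK Ωp L)
    (hIncl : ∀ (κ : ZpExtension K p), κ.IsAnticyclotomic → ∀ (γ : Field.absoluteGaloisGroup K) [Fact (κ.IsTopGenerator γ)]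
        (𝔭 : HeightOneSpectrum (𝓞 K)), ((p : ℕ) : 𝓞 K) ∈ 𝔭.asIdeal → 𝔭.asIdeal.ramificationIdx (𝓞 ℚ) = 1 →
        𝔭.asIdeal.inertiaDeg (𝓞 ℚ) = 1 → ∀ (𝔭' : HeightOneSpectrum (𝓞 K)), ((p : ℕ) : 𝓞 K) ∈ 𝔭'.asIdeal → 𝔭' ≠ 𝔭 →
        ∀ (ι' : PadicAlgCl p ≃+* ℂ), SchneiderFree.BranchInducesPrime p ι' 𝔭 →
        ∀ (ΩK : ℂ) (Ωp : ℂ_[p]) (L : UnrSeries p), ΩK ≠ 0 → Ωp ≠ 0 → IsBDPLFunction ι' 𝔭 κ γ Dt.f ΩK Ωp L →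
          Module.IsTorsion (IwasawaAlgebra p) (XAc (W.baseChange K) p κ 𝔭' ∅ γ) →
          (XAc.charIdeal (W.baseChange K) p κ 𝔭' ∅ γ).map (PowerSeries.map (toUnr p)) ≤ Ideal.span {L})
    (hCtl : ∀ (κ : ZpExtension K p), κ.IsAnticyclotomic → ∀ (γ : Field.absoluteGaloisGroup K) [Fact (κ.IsTopGenerator γ)]
        (𝔭 : HeightOneSpectrum (𝓞 K)) (h𝔭 : ((p : ℕ) : 𝓞 K) ∈ 𝔭.asIdeal) (he : 𝔭.asIdeal.ramificationIdx (𝓞 ℚ) = 1)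
        (hf : 𝔭.asIdeal.inertiaDeg (𝓞 ℚ) = 1), SchneiderFree.AdditiveControlOnTreeAt p κ 𝔭 γ (embAt K p 𝔭 h𝔭 he hf) P) :
    SchneiderFree.IndexLowerBoundLeAt W p K P (padicValNat p Dt.c.natAbs) := by
  have hp : p.Prime := Fact.out
  have hpN : p ∣ W.conductorNorm ℤ :=
    (W.dvd_conductorNorm_iff_not_hasGoodReductionAtPrime p).mpr (not_good_of_addv W p haddv)
  have hsplit : SplitsIn K p := by rw [hN] at hpN; exact hHN p hp hpN
  have hp2N : p ^ 2 ∣ N := by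
    rw [← hN]
    by_contra h
    rcases hasGoodReductionAtPrime_or_hasMultiplicativeReductionAtPrime_of_not_sq_dvd_conductorNorm (V := W) h
      with hg | hm
    · exact haddv.1 hg
    · exact haddv.2 hm
  obtain ⟨hrk, hfin⟩ := hKo hK hHN ⟨Dt, H, ι, hP⟩ hnt
  -- a frame `(κ, γ, 𝔭, 𝔭′ ≠ 𝔭)` and an `R₀`-frame there (hypothesis), read in `𝓞_{ℂ_p}⟦T⟧`
  obtain ⟨κ, γ, -, hκ, hγ, -⟩ := X11b.exists_anticyclotomic_generator_prime (p := p) hK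
  haveI : Fact (κ.IsTopGenerator γ) := ⟨hγ⟩
  obtain ⟨𝔭, h𝔭, he, hf⟩ := X11b.exists_degreeOnePrime_of_splitsIn K p hK.1 hsplit
  obtain ⟨𝔭', hne, h𝔭', he', hf'⟩ := X11b.Three.exists_ne_degreeOne_prime hK.1 h𝔭 he hf
  obtain ⟨ι', hind, ΩK, Ωp, L, hΩK, hΩp, hBDP⟩ := hFr κ hκ γ 𝔭 h𝔭
  set Q : PowerSeries (PadicComplexInt p) := PowerSeries.map (R1.unrToCpInt p) L with hQdef
  have hBDPQ : R1.IsBDPLFunctionInt p ι' 𝔭 κ γ Dt.f ΩK Ωp Q := R1.isBDPLFunctionInt_map hBDP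
  obtain ⟨u, hu, hval⟩ := intSeries_value_of_frame_manin hL W K 𝔭 κ γ Dt H ι P Dt.f Dt.isNewformOf hp2 hN hp2N hK hd4 h𝔭
    he hf hHN hκ hP hnt ι' hind hΩK hΩp hBDPQ
  -- control EQUALITY at `𝔭′`; its torsion conjunct feeds the guard of the `R₀`-inclusion
  obtain ⟨n, hn, hneq⟩ := hCtl κ hκ γ 𝔭' h𝔭' he' hf'
  have hle : (XAc.charIdeal (W.baseChange K) p κ 𝔭' ∅ γ).map (PowerSeries.map (R1.toCpInt p)) ≤ Ideal.span {Q} :=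
    ideal_map_toCpInt_le_span_of_map_toUnr_le _ L (hIncl κ hκ γ 𝔭 h𝔭 he hf 𝔭' h𝔭' hne ι' hind ΩK Ωp L hΩK hΩp hBDP hn.1)
  have hc0 : Dt.c ≠ 0 := Dt.maninConstant_ne_zero_holds
  have hc0' : (Dt.c : ℚ_[p]) ≠ 0 := by exact_mod_cast hc0
  have hlog : logOmega W p (embAt K p 𝔭' h𝔭' he' hf') P ≠ 0 := X11b.R1.logOmega_ne_zero W p _ hnt
  have hsq : (algebraMap ℚ_[p] ℂ_[p] (logOmega W p (embAt K p 𝔭 h𝔭 he hf) P / (Dt.c : ℚ_[p]))) ^ 2 =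
      (algebraMap ℚ_[p] ℂ_[p] (logOmega W p (embAt K p 𝔭' h𝔭' he' hf') P / (Dt.c : ℚ_[p]))) ^ 2 := by
    rw [← map_pow, ← map_pow, div_pow, div_pow,
      SchneiderFreeAdditiveX3.sq_logOmega_embAt_eq_of_rank_one W p hK.1 hrk h𝔭 he hf h𝔭' he' hf' P]
  have hval' : IntSeries.HasValueAt Q 0
      (u * (algebraMap ℚ_[p] ℂ_[p] (logOmega W p (embAt K p 𝔭' h𝔭' he' hf') P / (Dt.c : ℚ_[p]))) ^ 2) := by
    rw [← hsq]; exact hval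
  have hlow : SchneiderFree.AdditiveIMCLowerBDPOnTreeLeAt p κ 𝔭' γ (embAt K p 𝔭' h𝔭' he' hf')
      (padicValNat p Dt.c.natAbs) P := by
    obtain ⟨htors, f, hfI, hf0, hfn⟩ := hn
    have hmem : PowerSeries.map (R1.toCpInt p) f ∈ Ideal.span {Q} := by
      have h3 := hle
      rw [hfI, map_span_singleton_powerSeries] at h3
      exact (Ideal.span_singleton_le_iff_mem _).mp h3
    obtain ⟨-, hle'⟩ := int_two_mul_valuation_le_of_map_mem_span hf0 hmem hu hval'
    rw [div_eq_mul_inv, Padic.valuation_mul hlog (inv_ne_zero hc0'), Padic.valuation_inv,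
      Padic.valuation_intCast, valuation_logOmega hlog, hfn] at hle'
    refine ⟨n, ⟨htors, f, hfI, hf0, hfn⟩, ?_⟩
    simp only [padicValInt] at hle'
    linarith
  exact SchneiderFreeAdditiveX3.indexLowerBoundLeAt_of_imcLowerLe_of_control hN hK hHN hfin hlow ⟨n, hn, hneq⟩

end Datum

/-! ## §2 The row-local r = 1 LOWER half from the `R₀`-frame and the `R₀`-Eisenstein inclusion -/

/-- **The r = 1 LOWER half `MissingLowerBoundAt W p` at ANY odd additive prime from an `R₀`-frame supply, the `R₀`-Eisenstein
inclusion (torsion-guarded), exact control and the twists' r = 0 UPPER half — ROW-LOCAL** (twist hypotheses at Heegner fields of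
odd `d_K < −4`). `= missingLowerBoundAt_of_indexLower_of_twistUpperOdd_row ∘ §1`. CONDITIONAL; closes nothing.
[cite: JetchevSkinnerWan2017, §7.4.1 (arXiv:1512.06894 p. 30)] [cite: Castella2018, Thm. 3.1 and §3 (arXiv:1704.06608 pp. 8–9)]
[cite: LiuZhangZhang2018, Thm 1.5.1 and Thm 1.5.3 (Duke Math. J. 167 pp. 748–749)] [cite: GrossZagier1986, I.(6.3)] -/
theorem missingLowerBoundAt_of_unrFrame_of_unrEisenstein_of_control_of_twistUpper_row (p : ℕ) [Fact p.Prime] (hp2 : p ≠ 2)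
    (hL : LiuZhangZhang2018.thm151_thm153_modularCurve_heegnerVector_additive) (hF : ToricPublishedInputs)
    (W : WeierstrassCurve ℚ) [W.IsElliptic] [W.IsGloballyMinimal] (haddv : Addv W p) (hr : W.analyticRank = 1)
    (hFr : ∀ (N : ℕ) [NeZero N] (K : Type) [Field K] [NumberField K] (Dt : ModularParametrizationData W N),
      W.conductorNorm ℤ = N → IsImaginaryQuadratic K → SatisfiesHeegnerHypothesis N K →
      ∀ (κ : ZpExtension K p), κ.IsAnticyclotomic → ∀ (γ : Field.absoluteGaloisGroup K) [Fact (κ.IsTopGenerator γ)]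
        (𝔭 : HeightOneSpectrum (𝓞 K)), ((p : ℕ) : 𝓞 K) ∈ 𝔭.asIdeal →
        ∃ ι' : PadicAlgCl p ≃+* ℂ, SchneiderFree.BranchInducesPrime p ι' 𝔭 ∧
          ∃ (ΩK : ℂ) (Ωp : ℂ_[p]) (L : UnrSeries p), ΩK ≠ 0 ∧ Ωp ≠ 0 ∧ IsBDPLFunction ι' 𝔭 κ γ Dt.f ΩK Ωp L)
    (hIncl : ∀ (N : ℕ) [NeZero N] (K : Type) [Field K] [NumberField K] (Dt : ModularParametrizationData W N),
      W.conductorNorm ℤ = N → IsImaginaryQuadratic K → SatisfiesHeegnerHypothesis N K →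
      ∀ (κ : ZpExtension K p), κ.IsAnticyclotomic → ∀ (γ : Field.absoluteGaloisGroup K) [Fact (κ.IsTopGenerator γ)]
        (𝔭 : HeightOneSpectrum (𝓞 K)), ((p : ℕ) : 𝓞 K) ∈ 𝔭.asIdeal → 𝔭.asIdeal.ramificationIdx (𝓞 ℚ) = 1 →
        𝔭.asIdeal.inertiaDeg (𝓞 ℚ) = 1 → ∀ (𝔭' : HeightOneSpectrum (𝓞 K)), ((p : ℕ) : 𝓞 K) ∈ 𝔭'.asIdeal → 𝔭' ≠ 𝔭 →
        ∀ (ι' : PadicAlgCl p ≃+* ℂ), SchneiderFree.BranchInducesPrime p ι' 𝔭 →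
        ∀ (ΩK : ℂ) (Ωp : ℂ_[p]) (L : UnrSeries p), ΩK ≠ 0 → Ωp ≠ 0 → IsBDPLFunction ι' 𝔭 κ γ Dt.f ΩK Ωp L →
          Module.IsTorsion (IwasawaAlgebra p) (XAc (W.baseChange K) p κ 𝔭' ∅ γ) →
          (XAc.charIdeal (W.baseChange K) p κ 𝔭' ∅ γ).map (PowerSeries.map (toUnr p)) ≤ Ideal.span {L})
    (hCtl : ∀ (N : ℕ) [NeZero N] (K : Type) [Field K] [NumberField K] (Dt : ModularParametrizationData W N)
      (H : HeegnerDatum N (NumberField.discr K)) (ι : K →+* ℂ) (P : (W.baseChange K).toAffine.Point),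
      W.conductorNorm ℤ = N → IsImaginaryQuadratic K → SatisfiesHeegnerHypothesis N K →
      (W.quadraticTwist (NumberField.discr K : ℚ)).entireLFunction 1 ≠ 0 →
      WeierstrassCurve.Affine.Point.map ι.toRatAlgHom P = heegnerPointComplex Dt H → ¬ IsOfFinAddOrder P →
      Literature.NumberTheory.EllipticCurves.kolyvagin N W K →
      ∀ (κ : ZpExtension K p), κ.IsAnticyclotomic → ∀ (γ : Field.absoluteGaloisGroup K) [Fact (κ.IsTopGenerator γ)]
        (𝔭 : HeightOneSpectrum (𝓞 K)) (h𝔭 : ((p : ℕ) : 𝓞 K) ∈ 𝔭.asIdeal) (he : 𝔭.asIdeal.ramificationIdx (𝓞 ℚ) = 1)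
        (hf : 𝔭.asIdeal.inertiaDeg (𝓞 ℚ) = 1),
        SchneiderFree.AdditiveControlOnTreeAt p κ 𝔭 γ (embAt K p 𝔭 h𝔭 he hf) P)
    (hTwUp : ∀ (N : ℕ) [NeZero N] (K : Type) [Field K] [NumberField K]
      (Wd : WeierstrassCurve ℚ) [Wd.IsElliptic] [Wd.IsGloballyMinimal],
      W.conductorNorm ℤ = N → IsImaginaryQuadratic K → SatisfiesHeegnerHypothesis N K → Odd (NumberField.discr K) →
      NumberField.discr K < -4 → (∃ C : VariableChange ℚ, C • W.quadraticTwist (NumberField.discr K : ℚ) = Wd) →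
      (W.quadraticTwist (NumberField.discr K : ℚ)).entireLFunction 1 ≠ 0 → MissingUpperBoundAt Wd p) :
    MissingLowerBoundAt W p := by
  have hKo : ∀ (N : ℕ) [NeZero N] (W : WeierstrassCurve ℚ) (K : Type) [Field K] [NumberField K],
      Literature.NumberTheory.EllipticCurves.kolyvagin N W K := hF.2.1
  refine missingLowerBoundAt_of_indexLower_of_twistUpperOdd_row p hp2 hF W haddv hr ?_ hTwUp
  intro N _ K _ _ Dt H ι P hN hK hHN _hodd hd4 hLt hP hnt
  exact indexLowerBoundLeAt_of_unrFrame_of_unrInclLe_of_control hp2 hL Dt H ι P haddv hN hK hHN hd4 hP hnt (hKo N W K)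
    (fun κ hκ γ _ 𝔭 h𝔭 ↦ hFr N K Dt hN hK hHN κ hκ γ 𝔭 h𝔭)
    (fun κ hκ γ _ 𝔭 h𝔭 he hf 𝔭' h𝔭' hne ι' hind ΩK Ωp L hΩK hΩp hBDP htors ↦
      hIncl N K Dt hN hK hHN κ hκ γ 𝔭 h𝔭 he hf 𝔭' h𝔭' hne ι' hind ΩK Ωp L hΩK hΩp hBDP htors)
    (fun κ hκ γ _ 𝔭 h𝔭 he hf ↦ hCtl N K Dt H ι P hN hK hHN hLt hP hnt (hKo N W K) κ hκ γ 𝔭 h𝔭 he hf)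

/-! ## §3 K9's 19200 LOWER half on the tower-surjective wild rows from the TEXTS of UTD 20928 and SOED 20479 -/

/-- **The LOWER half of K9's residual `WildRankOne` (stmt-BirchSwinnertonDyer-19200) on the `3`-adic TOWER-SURJECTIVE rows,
from the registered texts of route UTD's child `WildSplitFrameAtThree` (stmt-BirchSwinnertonDyer-20928: an `R₀`-frame at the
wild split `3`) and route SOED's crux `WildSplitEisensteinInclusionAtThree` (stmt-BirchSwinnertonDyer-20479: the Eisenstein
inclusion in `R₀`-currency, torsion-guarded) — both hypotheses stated VERBATIM (no route file of SOED imported; a glue is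
`fun hFr hX => …`) — plus Kato A161″, the seven cohomological named facts, Liu–Zhang–Zhang 2018 and ToricPublishedInputs.**
Conclusion in 19200's binders: `∀ W, r_an = 1 → ClassO6 W 3 → TowerSurjThree W → MissingLowerBoundAt W 3`. Control is gen 20's
`additiveControl_heegner_potSS_of_facts_of_serre1967`; the twist's r = 0 upper half is `missingUpperBoundAt_twist_of_towerSurj_of_katoTam`.
CONDITIONAL; closes nothing; BSD₃ for no curve.
[cite: JetchevSkinnerWan2017, §7.4.1 and Thm. 3.3.1 (arXiv:1512.06894)] [cite: Castella2018, Thm. 3.1 and §3 (arXiv:1704.06608 pp. 8–9)]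
[cite: Kato2004Asterisque, Thm. 14.5 (3), Prop. 14.16 (2)] [cite: LiuZhangZhang2018, Thm 1.5.1 and Thm 1.5.3 (Duke Math. J. 167 pp. 748–749)]
[cite: Serre1967GroupesPDivisibles, §5 Prop. 8] [cite: GrossZagier1986, I.(6.3)] -/
theorem missingLowerBoundAt_wildRankOne_towerSurj_of_frame20928_of_eisenstein20479_of_katoTam_of_facts
    [Fact (3 : ℕ).Prime]
    (hL : LiuZhangZhang2018.thm151_thm153_modularCurve_heegnerVector_additive)
    (hF : ToricPublishedInputs)
    (hKatoT : Kato2004.rankZero_padicValNat_sha_add_padicValNat_tamagawa_le_of_additive_potGood_of_imageContainsSL2)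
    (hPT : ∀ (K : Type) [Field K] [NumberField K], poitouTate_selmerStructure_duality K)
    (hPT2 : ∀ (K : Type) [Field K] [NumberField K], poitouTate_sha_tateDual K)
    (hEP : ∀ (K : Type) [Field K] [NumberField K] (v : HeightOneSpectrum (𝓞 K)),
      localEulerPoincareCharacteristic (v.adicCompletion K))
    (hcd : fieldCdLE_two_of_numberField)
    (hBr : ∀ (K : Type) [Field K] [NumberField K] (p : ℕ) [Fact p.Prime],
      ZpExtension.decomp_not_le_kerSubgroup_of_isAnticyclotomic K p)
    (hBr2 : ∀ (K : Type) [Field K] [NumberField K] (p : ℕ) [Fact p.Prime],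
      ZpExtension.decomp_not_le_kerSubgroup_above_of_isAnticyclotomic K p)
    (hS : Serre1967.noStableDivisibleLine_of_potentiallySupersingular)
    (hFr : ∀ (W : WeierstrassCurve ℚ) [W.IsElliptic] [W.IsGloballyMinimal] (N : ℕ) [NeZero N] (K : Type) [Field K]
      [NumberField K] (Dt : ModularParametrizationData W N), ClassO6 W 3 → W.conductorNorm ℤ = N → IsImaginaryQuadratic K →
      SatisfiesHeegnerHypothesis N K → ∀ (κ : ZpExtension K 3), κ.IsAnticyclotomic →
      ∀ (γ : Field.absoluteGaloisGroup K) [Fact (κ.IsTopGenerator γ)] (𝔭 : HeightOneSpectrum (𝓞 K)),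
        ((3 : ℕ) : 𝓞 K) ∈ 𝔭.asIdeal → ∃ ι' : PadicAlgCl 3 ≃+* ℂ, SchneiderFree.BranchInducesPrime 3 ι' 𝔭 ∧
          ∃ (ΩK : ℂ) (Ωp : ℂ_[3]) (L : UnrSeries 3), ΩK ≠ 0 ∧ Ωp ≠ 0 ∧ IsBDPLFunction ι' 𝔭 κ γ Dt.f ΩK Ωp L)
    (hX : ∀ (W : WeierstrassCurve ℚ) [W.IsElliptic] [W.IsGloballyMinimal] (N : ℕ) [NeZero N] (K : Type) [Field K]
      [NumberField K] (Dt : ModularParametrizationData W N), ClassO6 W 3 → W.HasSurjectiveModNGaloisRep 3 →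
      W.analyticRank = 1 → W.conductorNorm ℤ = N → IsImaginaryQuadratic K → SatisfiesHeegnerHypothesis N K →
      ∀ (κ : ZpExtension K 3), κ.IsAnticyclotomic → ∀ (γ : Field.absoluteGaloisGroup K) [Fact (κ.IsTopGenerator γ)]
        (𝔭 : HeightOneSpectrum (𝓞 K)), ((3 : ℕ) : 𝓞 K) ∈ 𝔭.asIdeal → 𝔭.asIdeal.ramificationIdx (𝓞 ℚ) = 1 →
        𝔭.asIdeal.inertiaDeg (𝓞 ℚ) = 1 → ∀ (𝔭' : HeightOneSpectrum (𝓞 K)), ((3 : ℕ) : 𝓞 K) ∈ 𝔭'.asIdeal → 𝔭' ≠ 𝔭 →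
        ∀ (ι' : PadicAlgCl 3 ≃+* ℂ), SchneiderFree.BranchInducesPrime 3 ι' 𝔭 →
        ∀ (ΩK : ℂ) (Ωp : ℂ_[3]) (L : UnrSeries 3), ΩK ≠ 0 → Ωp ≠ 0 → IsBDPLFunction ι' 𝔭 κ γ Dt.f ΩK Ωp L →
          Module.IsTorsion (IwasawaAlgebra 3) (XAc (W.baseChange K) 3 κ 𝔭' ∅ γ) →
          (XAc.charIdeal (W.baseChange K) 3 κ 𝔭' ∅ γ).map (PowerSeries.map (toUnr 3)) ≤ Ideal.span {L}) :
    ∀ (W : WeierstrassCurve ℚ) [W.IsElliptic] [W.IsGloballyMinimal], W.analyticRank = 1 → ClassO6 W 3 →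
      AdditiveThree.TowerSurjThree W → MissingLowerBoundAt W 3 := by
  intro W _ _ hr hO6 hT
  have hsurj := forall_hasSurjectiveModNGaloisRep_pow_three_of_towerSurjThree W hT
  have h1 : W.HasSurjectiveModNGaloisRep 3 := by
    have h := hsurj 1
    simp only [pow_one] at h
    exact_mod_cast h
  have haddv : Addv W 3 := hO6.2.1
  have hj : 0 ≤ padicValRat 3 W.j := hO6.padicValRat_j_nonneg
  have hirr : W.HasIrreducibleModPGaloisRep 3 := by
    haveI : NeZero ((3 : ℕ) : ℚ) := ⟨by norm_num⟩
    exact hasIrreducibleModPGaloisRep_of_hasSurjectiveModNGaloisRep W 3 (by exact_mod_cast h1)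
  have hGZK : rank_eq_analyticRank_of_analyticRank_le_one := hF.2.2.1
  have hmod : hasEntireLFunction_rat := hF.2.2.2.1
  exact missingLowerBoundAt_of_unrFrame_of_unrEisenstein_of_control_of_twistUpper_row 3 (by decide) hL hF W haddv hr
    (fun N _ K _ _ Dt hN hK hHN κ hκ γ _ 𝔭 h𝔭 ↦ hFr W N K Dt hO6 hN hK hHN κ hκ γ 𝔭 h𝔭)
    (fun N _ K _ _ Dt hN hK hHN κ hκ γ _ 𝔭 h𝔭 he hf 𝔭' h𝔭' hne ι' hind ΩK Ωp L hΩK hΩp hBDP htors ↦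
      hX W N K Dt hO6 h1 hr hN hK hHN κ hκ γ 𝔭 h𝔭 he hf 𝔭' h𝔭' hne ι' hind ΩK Ωp L hΩK hΩp hBDP htors)
    (fun N _ K _ _ Dt H ι P hN hK hHN _hLt hP hnt hKo κ hκ γ _ 𝔭 h𝔭 he hf ↦
      additiveControl_heegner_potSS_of_facts_of_serre1967 hPT hPT2 hEP hcd hBr hBr2 hS 3 W N K Dt H ι P (Or.inr hO6) hirr
        hN hK hHN hP hnt hKo κ hκ γ 𝔭 h𝔭 he hf)
    (fun N _ K _ _ Wd _ _ hN hK hHN _hodd _hd4 hC hLt ↦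
      missingUpperBoundAt_twist_of_towerSurj_of_katoTam 3 (by decide) hKatoT hGZK hmod W haddv hj hsurj hN K hK hHN Wd hC hLt)

end Summit.BirchSwinnertonDyer.BirchSwinnertonDyer.Theorems.UniversalToricDescentWaldspurgerFlat

end
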